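import Mathlib
import Summits.KontsevichZagierPeriods.Statement
import Summits.KontsevichZagierPeriods.KontsevichZagierPeriods.Theses.TerasomaMultiplication
import Summits.KontsevichZagierPeriods.KontsevichZagierPeriods.Theses.MotivatedMoves
import Summits.KontsevichZagierPeriods.KontsevichZagierPeriods.Theses.CompiledSubstitutions

/-!
# Crux GammaHodgeSector (stmt-KontsevichZagierPeriods-3742) — ideator-4 sketch (round 2)

First lemmas of two crux idea cards; every `def … : Prop` elaborates; the only proof is the
shape-glue `deepThirtyThree_iff_verbatim` (rfl-level bookkeeping is NOT attempted here).

* Card `raise-to-66-isogeny` (level-raising kills the certified hardness instance):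
  `IsogenyPairSixtySix` (ONE Hodge-type linear Beta pair of level 66 — an instance of
  `MotivatedMoves.GammaHodgePairs`, N = N' = 1, k = 0, i.e. a CM isogeny between two factors of
  J(F₆₆)), `DasDeepThirtyThree` (verbatim from SketchIdeator3, the level-33 'deep' quadratic pair)
  and the transfer shape `DeepThirtyThreeFromSixtySix`; plus the decidable lattice vocabulary
  `linPairVec` / `RaisedClassDies` recording the 𝔽₂/ℤ certificate that was RUN (num/raise66.py,
  num/pairs66.py, num/raiseF2.py in the ideator folder).
* Card `weil-principle-b-transport` (Principle B is a Newton–Leibniz move with a RATIONAL gauge):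
  `RationalGaugeTransport` (engine over boxes, generalising SketchIdeator3.AlgebraicGaugeTransport:
  the gauge is any semialgebraic non-vanishing function of the parameter, no ODE / finite monodromy
  hypothesis — the certificate is a divergence identity) and `WeilSignatureDictionary` (the crux's
  Hodge test IS the Weil signature condition of the CM abelian variety Π J_{x_j,y_j} × Π J_{x'_l,y'_l}^∨).
-/

noncomputable section

namespace Summit.KontsevichZagierPeriods.KontsevichZagierPeriods.Cruxes.GammaHodgeSector.SketchIdeator4

open Literature.NumberTheory.Transcendental

/-! ## Card A — `raise-to-66-isogeny` -/

/-- ONE level-66 isogeny pair (Hodge-type LINEAR Beta pair, `N = N' = 1`, `k = 0`):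
`B(1/22, 1/3) = c · B(1/22, 16/33)`, `c = Γ(1/3)Γ(35/66)/(Γ(16/33)Γ(25/66)) = 1.046116123681…`
(real algebraic by Deligne 1982 Thm 7.18 / Koblitz–Ogus; the two Fermat-curve factors
`J_(3,22,41)`, `J_(3,32,31)` of `J(F₆₆)` have the same CM type, hence are isogenous —
Koblitz–Rohrlich).  Value equality and algebraicity of `c` are hypotheses, exactly as in the crux.
Any one of 540 such level-66 pairs does the same job (num/pairs66.py); this is the one with the
smallest denominators. It is an INSTANCE of `MotivatedMoves.GammaHodgePairs` (surface sector). -/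
def IsogenyPairSixtySix : Prop :=
  ∀ (c : ℝ), IsAlgebraic ℚ c → ∀ (r r' : KZ.IntegralRep 1),
    r.domain = {t | t 0 ∈ Set.Ioo (0:ℝ) 1} →
    Set.EqOn r.integrand (fun t => (t 0) ^ (-(21:ℝ)/22) * (1 - t 0) ^ (-(2:ℝ)/3)) r.domain →
    r'.domain = {t | t 0 ∈ Set.Ioo (0:ℝ) 1} →
    Set.EqOn r'.integrand (fun t => c * ((t 0) ^ (-(21:ℝ)/22) * (1 - t 0) ^ (-(17:ℝ)/33))) r'.domain →
    r.value = r'.value → KZ.Equivalent r r'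

/-- `DasDeepThirtyThree` (verbatim from SketchIdeator3): `B(1/33,1/33)·B(2/33,22/33) =
c·B(1/33,3/33)·B(2/33,14/33)`, the level-33 quadratic pair whose Γ-class is da Silva's
non-standard Hodge class on the Fermat fourfold `X⁴₃₃` modulo `S₃₃` (HARDNESS-Fermat33.md). -/
def DasDeepThirtyThree : Prop :=
  ∀ (c : ℝ), IsAlgebraic ℚ c → ∀ (r r' : KZ.IntegralRep 2),
    r.domain = {x | ∀ i, x i ∈ Set.Ioo (0:ℝ) 1} →
    Set.EqOn r.integrand (fun x => (x 0) ^ (-(32:ℝ)/33) * (1 - x 0) ^ (-(32:ℝ)/33) *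
      ((x 1) ^ (-(31:ℝ)/33) * (1 - x 1) ^ (-(11:ℝ)/33))) r.domain →
    r'.domain = {x | ∀ i, x i ∈ Set.Ioo (0:ℝ) 1} →
    Set.EqOn r'.integrand (fun x => c * ((x 0) ^ (-(32:ℝ)/33) * (1 - x 0) ^ (-(30:ℝ)/33) *
      ((x 1) ^ (-(31:ℝ)/33) * (1 - x 1) ^ (-(19:ℝ)/33)))) r'.domain →
    r.value = r'.value → KZ.Equivalent r r'

/-- TRANSFER SHAPE of card A (the first lemma a line would register as its composition target):
the certified 'deep' instance follows from the route's STANDARD items and ONE surface pair of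
level 66.  Informal proof = the landed parametric relator compiler
`GammaHodgeSectorKO.gammaHodgeSector_of_solvedPairs` with solved set `{IsogenyPairSixtySix}` and
relators at level 66 (duplication n = 2 and the Gauss vectors for m ∣ 66), fed by the ℤ-lattice
certificate `f(DasDeep33) ∈ S₆₆ + ℤ·(pair)` (num/pairs66.py; NOT in `S₆₆`, NOT in `S₃₃ + LP₃₃`). -/
def DeepThirtyThreeFromSixtySix : Prop :=
  Summit.KontsevichZagierPeriods.KontsevichZagierPeriods.Theses.TerasomaMultiplication.MultiplicationAccessible →
  Summit.KontsevichZagierPeriods.KontsevichZagierPeriods.Theses.CompiledSubstitutions.EulerReflectionRational →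
  Summit.KontsevichZagierPeriods.KontsevichZagierPeriods.Theses.TerasomaMultiplication.BetaCancellation →
  IsogenyPairSixtySix → DasDeepThirtyThree

/-- Lattice vocabulary for the certificate (same conventions as SketchIdeator3.standardSpan):
basis vector of a class. -/
def eVec (N : ℕ) [NeZero N] (x : ZMod N) : ZMod N → ℤ :=
  fun a => if a = x ∧ a ≠ 0 then 1 else 0

/-- reflection vector `[x] + [−x]`. -/
def reflVec (N : ℕ) [NeZero N] (x : ZMod N) : ZMod N → ℤ := eVec N x + eVec N (-x)

/-- distribution (Gauss multiplication) vector for `m ∣ N`. -/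
def distVec (N : ℕ) [NeZero N] (m : ℕ) (y : ZMod N) : ZMod N → ℤ :=
  (fun a => if (m : ZMod N) * a = y ∧ a ≠ 0 then 1 else 0) - eVec N y

/-- Γ-class of the linear Beta pair `B(a,b) ∝ B(a',b')`: `j(a,b) − j(a',b')`, `j(a,b) = [a]+[b]−[a+b]`. -/
def linPairVec (N : ℕ) [NeZero N] (a b a' b' : ZMod N) : ZMod N → ℤ :=
  (eVec N a + eVec N b - eVec N (a + b)) - (eVec N a' + eVec N b' - eVec N (a' + b'))

/-- the standard span `S_N` (reflections + distribution vectors for every `m ∣ N`, `m > 1`). -/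
def standardSpan (N : ℕ) [NeZero N] : AddSubgroup (ZMod N → ℤ) :=
  AddSubgroup.closure
    ({v | ∃ x : ZMod N, v = reflVec N x} ∪
     {v | ∃ (m : ℕ) (y : ZMod N), 1 < m ∧ m ∣ N ∧ v = distVec N m y})

/-- the da Silva / Fermat-33 Γ-class RAISED to level 66 (`x ↦ 2x`): `Σ_{i} [2aᵢ/66]`,
`a = (7,10,13,19,22,28)`. -/
def fermat33Raised : ZMod 66 → ℤ :=
  eVec 66 14 + eVec 66 20 + eVec 66 26 + eVec 66 38 + eVec 66 44 + eVec 66 56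

/-- THE CERTIFICATE THAT WAS RUN (card A, decidable arithmetic; num/raise66.py + num/pairs66.py, exact
integer echelon bases): the raised level-33 class lies in `S₆₆ + ℤ·(one level-66 isogeny pair)` —
here the pair `B(1/22,1/3) ∝ B(1/22,16/33)`, i.e. classes `(3,22 | 3,32)` of `ℤ/66` — although it is
NOT in `S₆₆` (only its double is) and NOT in `S₃₃ + LP₃₃`. -/
def RaisedClassDies : Prop :=
  fermat33Raised ∈ standardSpan 66 ⊔ AddSubgroup.zmultiples (linPairVec 66 3 22 3 32) ∧
  fermat33Raised ∉ standardSpan 66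

/-! ## Card B — `weil-principle-b-transport` -/

/-- ENGINE (transcendence-free, provable-now candidate from `GaussManinCertificates.KZStokesBox` +
integrand additivity): RATIONAL-GAUGE TRANSPORT over a box.  A one-parameter family of integrands
`F s x` on a fixed open box `Π (a i, b i)`, a semialgebraic gauge `R` with `R s ≠ 0` on `[s₀, s₁]`, and a
semialgebraic divergence certificate `G i` with `∂ₛ (F s x / R s) = Σᵢ ∂_{xᵢ} (G i s x)` on the open
box and `G i` vanishing on the two faces `xᵢ = a i`, `xᵢ = b i`: then the two gauged fibres
`[box, F s₀ / R s₀]` and `[box, F s₁ / R s₁]` are KZ-equivalent.  No hypergeometric equation, no finite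
monodromy: when `F s` is the naive period integrand of a flat HODGE class along an algebraic family
and `R` its (rational, by flatness + polarisation + regularity) period function, this IS Deligne's
Principle B inside the rules. -/
def RationalGaugeTransport : Prop :=
  ∀ (n : ℕ) (a b : Fin (n + 1) → ℝ) (s₀ s₁ : ℝ), (∀ i, a i < b i) → s₀ < s₁ →
    IsAlgebraic ℚ s₀ → IsAlgebraic ℚ s₁ →
  ∀ (F : ℝ → (Fin (n + 1) → ℝ) → ℝ) (dF : ℝ → (Fin (n + 1) → ℝ) → ℝ) (R dR : ℝ → ℝ)
    (G dG : Fin (n + 1) → ℝ → (Fin (n + 1) → ℝ) → ℝ),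
    IsSemialgebraicFunOn ℚ {p : Fin (n + 2) → ℝ | p 0 ∈ Set.Icc s₀ s₁ ∧
        ∀ i : Fin (n + 1), p i.succ ∈ Set.Icc (a i) (b i)} (fun p => F (p 0) (fun i => p i.succ)) →
    IsSemialgebraicFunOn ℚ {p : Fin 1 → ℝ | p 0 ∈ Set.Icc s₀ s₁} (fun p => R (p 0)) →
    (∀ i, IsSemialgebraicFunOn ℚ {p : Fin (n + 2) → ℝ | p 0 ∈ Set.Icc s₀ s₁ ∧
        ∀ i : Fin (n + 1), p i.succ ∈ Set.Icc (a i) (b i)} (fun p => G i (p 0) (fun i => p i.succ))) →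
    (∀ s ∈ Set.Icc s₀ s₁, R s ≠ 0) →
    (∀ s ∈ Set.Ioo s₀ s₁, HasDerivAt R (dR s) s) →
    (∀ s ∈ Set.Ioo s₀ s₁, ∀ x, (∀ i, x i ∈ Set.Ioo (a i) (b i)) →
        HasDerivAt (fun σ => F σ x) (dF s x) s ∧
        (∀ i, HasDerivAt (fun ξ => G i s (Function.update x i ξ)) (dG i s x) (x i)) ∧
        (dF s x * R s - F s x * dR s) / (R s) ^ 2 = ∑ i, dG i s x) →
    (∀ i, ∀ s ∈ Set.Icc s₀ s₁, ∀ x, (∀ j, x j ∈ Set.Icc (a j) (b j)) →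
        (x i = a i ∨ x i = b i) → G i s x = 0) →
    ∀ (r₀ r₁ : KZ.IntegralRep (n + 1)),
      r₀.domain = {x | ∀ i, x i ∈ Set.Ioo (a i) (b i)} →
      Set.EqOn r₀.integrand (fun x => F s₀ x / R s₀) r₀.domain →
      r₁.domain = {x | ∀ i, x i ∈ Set.Ioo (a i) (b i)} →
      Set.EqOn r₁.integrand (fun x => F s₁ x / R s₁) r₁.domain →
      KZ.Equivalent r₀ r₁

/-- Hodge-type indicator `h_u(x,y) = ⟨ux⟩ + ⟨uy⟩ − ⟨u(x+y)⟩ ∈ {0,1}` (= 1 iff `u` lies in the CM type of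
the Fermat-curve factor `J_{x,y}` carrying `B(x,y)`). -/
def hodgeIndicator (u : ℕ) (x y : ℚ) : ℚ :=
  Int.fract ((u:ℚ) * x) + Int.fract ((u:ℚ) * y) - Int.fract ((u:ℚ) * (x + y))

/-- DICTIONARY (card B, decidable bookkeeping, provable now): the crux's Hodge test says exactly that,
for every unit `u`, the `σ_u`-part of `H^{1,0}` of the CM abelian variety
`B = Π_j J_{x_j,y_j} × Π_l J_{x'_l,y'_l}^∨` (`K = ℚ(ζ_D)`-rank `N + N'`) has dimension `k + N'`,
INDEPENDENT of `u` — with the weight balance `N + N' = 2(k + N')` (Disproof §3, no integer sums)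
this is the WEIL SIGNATURE `(n,n)`, `n = (N+N')/2`, at every embedding: the Deligne class of the
instance is the Weil class `⋀^{N+N'}_K H¹(B)`, Hodge on EVERY member of the `n²·φ(D)/2`-dimensional
Weil family through `B`. -/
def WeilSignatureDictionary : Prop :=
  ∀ (N N' k : ℕ) (x y : Fin N → ℚ) (x' y' : Fin N' → ℚ),
    (∀ j, 0 < x j ∧ 0 < y j ∧ Int.fract (x j) ≠ 0 ∧ Int.fract (y j) ≠ 0 ∧ Int.fract (x j + y j) ≠ 0) →
    (∀ l, 0 < x' l ∧ 0 < y' l ∧ Int.fract (x' l) ≠ 0 ∧ Int.fract (y' l) ≠ 0 ∧ Int.fract (x' l + y' l) ≠ 0) →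
    ∀ u : ℕ, 0 < u → (∀ j, Nat.Coprime u (x j).den ∧ Nat.Coprime u (y j).den) →
      (∀ l, Nat.Coprime u (x' l).den ∧ Nat.Coprime u (y' l).den) →
      (((∑ j, hodgeIndicator u (x j) (y j)) - ∑ l, hodgeIndicator u (x' l) (y' l) = (k : ℚ)) ↔
       ((∑ j, hodgeIndicator u (x j) (y j)) + ∑ l, (1 - hodgeIndicator u (x' l) (y' l)) = (k : ℚ) + N'))

end Summit.KontsevichZagierPeriods.KontsevichZagierPeriods.Cruxes.GammaHodgeSector.SketchIdeator4
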